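import Summits.ValiantsHypothesis.ValiantsHypothesis.Theses.FermionizationDimension
import Summits.ValiantsHypothesis.ValiantsHypothesis.Theorems.FermionizationDimensionAssembly
import Summits.ValiantsHypothesis.ValiantsHypothesis.Theorems.ClassTransfer.Negative.ConeLevel

/-!
# Crux `ClassTransfer` (stmt-ValiantsHypothesis-7287), line `registered` (birth):
# the OBLIVIOUS-SPLIT DICHOTOMY — no circuit-independent membership cut of the crux is both
# provable and useful

Lead prover (gen 1) of the only line of the crux
`Summit.ValiantsHypothesis.ValiantsHypothesis.Theses.FermionizationDimension.ClassTransfer`.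
The line `Cruxes/ClassTransfer/Lines/birth.lean` cuts the crux into

* a STRUCTURAL half `B`: for every class-function family `χ` whose generalized-matrix-function
  family is in `VP`, the twisted function `sgn · χ_n` lies in an explicit class `X_c(n)` of
  functions on `S_n` for some constant `c` and every `n` (there: the cheap cone of level
  `(log₂ n + c)^c`), and
* an ALGEBRAIC half `A`: every member of `X_c(n)` has a commutative twisting realisation
  `ℓ(∏ u_{σ(i),i}) = f(σ)` of dimension `≤ s_c(n)` with `s_c` quasi-polynomially bounded
  (there: `(n+2)^(2(log₂ n + c)^c+1)`, landed as `stub_cheapConeRealisable`, p147627),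

where the class `X` does not look at the circuit — it is a fixed family of sets of functions.
The gen-0 lead found the structural half summit-hard (`Negative/ConeLevel.lean`, p149705).  This
file records, kernel-checked, that the phenomenon is not an accident of the cone but of the SHAPE
of the cut: for EVERY circuit-oblivious class `X : ℕ → (n : ℕ) → (S_n → ℂ) → Prop`,

* `not_sDimPerNotQP_of_sign_mem` — if the sign character itself lies in `X_c(n)` for one `c` and
  all `n`, then the algebraic half `A` ALONE refutes the route's other crux `SDimPerNotQP`
  (it realises `sgn_n` in quasi-polynomial dimension for every `n`) — the route dies;
* `valiantsHypothesis_of_sign_not_mem` — if for every `c` some `sgn_n` is outside `X_c(n)`, then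
  the structural half `B` ALONE proves `ValiantsHypothesis` (apply it to `χ ≡ 1`, whose GMF family
  is the permanent family: `per ∈ VP` would put `sgn_n = sgn_n · 1` in `X_c(n)`), with no use of
  `A`, of `SDimPerNotQP`, or of anything else in the route;
* `obliviousSplit_dichotomy` — the two horns packaged: `A ∧ B → ¬ SDimPerNotQP ∨ ValiantsHypothesis`
  by excluded middle on `∃ c, ∀ n, sgn_n ∈ X_c(n)`;
* `coneLine_on_horn_two` — the registered line sits on the second horn
  (`sign_not_mem_cheapCone` at `n = 2 (log₂ n + c)^c + 4`), which is `ConeLevel.lean`'s verdict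
  re-derived through the dichotomy.

So a reshape of the line that keeps its composition idea (membership in a circuit-independent
class + cheap realisability of that class) cannot help this route: a surviving line for
`ClassTransfer` must make `X` depend on the circuit (a normal-form transfer from a circuit or a
determinantal representation of `d_χ` to a twisted determinant), which is the crux's open content.
No definitions; the class `X` is a bound variable. [folklore]
-/

set_option linter.dupNamespace false

namespace Summit.ValiantsHypothesis.ValiantsHypothesis.Theorems.ClassTransfer.Negative

open Literature.Computability.AlgebraicComplexity
open Summit.ValiantsHypothesis.ValiantsHypothesis.Theses.FermionizationDimension

/-- **Horn 1: if the class contains the sign character, the algebraic half refutes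
`SDimPerNotQP`.**  `A` (every member of `X_c(n)` realisable in dimension `≤ s_c(n)`, `s_c`
quasi-polynomially bounded) applied to `sgn_n ∈ X_c(n)` gives realisations of `sgn_n` of
dimension `≤ s_c(n)` for all `n`, which `SDimPerNotQP` forbids at its witness `n`. [folklore] -/
theorem not_sDimPerNotQP_of_sign_mem
    (X : ℕ → (n : ℕ) → (Equiv.Perm (Fin n) → ℂ) → Prop)
    (hA : ∀ c : ℕ, ∃ s : ℕ → ℕ, IsQPBounded s ∧
      ∀ (n : ℕ) (f : Equiv.Perm (Fin n) → ℂ), X c n f →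
        ∃ (R : Type) (_ : CommRing R) (_ : Algebra ℂ R) (_ : Module.Finite ℂ R)
          (u : Fin n → Fin n → R) (ℓ : R →ₗ[ℂ] ℂ),
          Module.finrank ℂ R ≤ s n ∧ ∀ σ : Equiv.Perm (Fin n), ℓ (∏ i, u (σ i) i) = f σ)
    (hsgn : ∃ c : ℕ, ∀ n : ℕ, X c n (fun σ => ((Equiv.Perm.sign σ : ℤ) : ℂ))) :
    ¬ SDimPerNotQP := by
  intro hS
  obtain ⟨c, hc⟩ := hsgn
  obtain ⟨s, hs, hreal⟩ := hA c
  obtain ⟨n, hn⟩ := hS s hs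
  obtain ⟨R, _, _, _, u, ℓ, hdim, hu⟩ := hreal n _ (hc n)
  have hlt : s n < Module.finrank ℂ R := hn R u ℓ hu
  omega

/-- **Horn 2: if the class misses the sign character somewhere for every constant, the structural
half is the summit.**  `B` (every `VP` class-function family has `sgn · χ_n ∈ X_c(n)` for some `c`
and all `n`) at `χ ≡ 1` — conjugation invariant, with GMF family the permanent family
(`gmfFamily_one_eq_perFamily`) — turns `per ∈ VP` into `sgn_n ∈ X_c(n)` for all `n`, against the
hypothesis; so `per ∉ VP`, and the hub lemma `valiantsHypothesis_of_not_isVPFamily_per` (with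
`mem_VP_ofFintype_iff_holds`, `perFamily_mem_VNP_holds`) concludes `VP ≠ VNP`. [folklore] -/
theorem valiantsHypothesis_of_sign_not_mem
    (X : ℕ → (n : ℕ) → (Equiv.Perm (Fin n) → ℂ) → Prop)
    (hB : ∀ χ : (n : ℕ) → Equiv.Perm (Fin n) → ℂ,
      (∀ n (σ τ : Equiv.Perm (Fin n)), IsConj σ τ → χ n σ = χ n τ) →
      IsVPFamily (k := ℂ)
        (fun n => ∑ σ : Equiv.Perm (Fin n),
          MvPolynomial.C (χ n σ) * ∏ i : Fin n, MvPolynomial.X (σ i, i)) →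
      ∃ c : ℕ, ∀ n : ℕ, X c n (fun σ => ((Equiv.Perm.sign σ : ℤ) : ℂ) * χ n σ))
    (hsgn : ∀ c : ℕ, ∃ n : ℕ, ¬ X c n (fun σ => ((Equiv.Perm.sign σ : ℤ) : ℂ))) :
    _root_.ValiantsHypothesis := by
  refine Summit.ValiantsHypothesis.Hub.valiantsHypothesis_of_not_isVPFamily_per ?_
    (mem_VP_ofFintype_iff_holds _) (perFamily_mem_VNP_holds ℂ)
  intro hper
  have hfam : IsVPFamily (k := ℂ)
      (fun n => ∑ σ : Equiv.Perm (Fin n),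
        MvPolynomial.C ((fun (m : ℕ) (_ : Equiv.Perm (Fin m)) => (1 : ℂ)) n σ) *
          ∏ i : Fin n, MvPolynomial.X (σ i, i)) := by
    rw [Summit.ValiantsHypothesis.Theorems.FermionizationDimension.gmfFamily_one_eq_perFamily]
    exact hper
  obtain ⟨c, hc⟩ := hB (fun (m : ℕ) (_ : Equiv.Perm (Fin m)) => (1 : ℂ)) (fun _ _ _ _ => rfl) hfam
  obtain ⟨n, hn⟩ := hsgn c
  apply hn
  have h1 : (fun σ : Equiv.Perm (Fin n) =>
      ((Equiv.Perm.sign σ : ℤ) : ℂ) * (fun (m : ℕ) (_ : Equiv.Perm (Fin m)) => (1 : ℂ)) n σ) =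
      fun σ => ((Equiv.Perm.sign σ : ℤ) : ℂ) := funext fun σ => mul_one _
  rw [← h1]
  exact hc n

/-- **The oblivious-split dichotomy.**  For every circuit-independent class `X`, the two halves
of a membership cut of `ClassTransfer` — `A`: `X_c(n)` realisable in quasi-polynomial dimension;
`B`: `VP` class functions (sgn-twisted) land in `X_c(n)` — together yield
`¬ SDimPerNotQP ∨ ValiantsHypothesis`, and more precisely ONE of them alone does: `A` refutes the
sibling crux (horn 1) or `B` proves the summit (horn 2), by excluded middle on
`∃ c, ∀ n, sgn_n ∈ X_c(n)`.  Hence no such cut is a usable decomposition of the crux inside route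
`FermionizationDimension`. [folklore] -/
theorem obliviousSplit_dichotomy
    (X : ℕ → (n : ℕ) → (Equiv.Perm (Fin n) → ℂ) → Prop)
    (hA : ∀ c : ℕ, ∃ s : ℕ → ℕ, IsQPBounded s ∧
      ∀ (n : ℕ) (f : Equiv.Perm (Fin n) → ℂ), X c n f →
        ∃ (R : Type) (_ : CommRing R) (_ : Algebra ℂ R) (_ : Module.Finite ℂ R)
          (u : Fin n → Fin n → R) (ℓ : R →ₗ[ℂ] ℂ),
          Module.finrank ℂ R ≤ s n ∧ ∀ σ : Equiv.Perm (Fin n), ℓ (∏ i, u (σ i) i) = f σ)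
    (hB : ∀ χ : (n : ℕ) → Equiv.Perm (Fin n) → ℂ,
      (∀ n (σ τ : Equiv.Perm (Fin n)), IsConj σ τ → χ n σ = χ n τ) →
      IsVPFamily (k := ℂ)
        (fun n => ∑ σ : Equiv.Perm (Fin n),
          MvPolynomial.C (χ n σ) * ∏ i : Fin n, MvPolynomial.X (σ i, i)) →
      ∃ c : ℕ, ∀ n : ℕ, X c n (fun σ => ((Equiv.Perm.sign σ : ℤ) : ℂ) * χ n σ)) :
    ¬ SDimPerNotQP ∨ _root_.ValiantsHypothesis := by
  by_cases h : ∃ c : ℕ, ∀ n : ℕ, X c n (fun σ => ((Equiv.Perm.sign σ : ℤ) : ℂ))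
  · exact Or.inl (not_sDimPerNotQP_of_sign_mem X hA h)
  · push Not at h
    exact Or.inr (valiantsHypothesis_of_sign_not_mem X hB h)

/-- **The registered line sits on horn 2.**  For the cheap cone of level `(log₂ n + c)^c`
(the class of line `birth`, written as the registered expansion), the sign character is outside
`X_c(n)` at `n` with `2 (log₂ n + c)^c + 4 ≤ n` (`sign_not_mem_cheapCone`,
`exists_two_mul_level_add_four_le`); so by `valiantsHypothesis_of_sign_not_mem` its structural
stub is summit-hard — `ConeLevel.lean`'s verdict, re-derived through the dichotomy. [folklore] -/
theorem coneLine_on_horn_two (c : ℕ) :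
    ∃ n : ℕ, ¬ ∃ a : ℕ → Finset (Fin n) → Equiv.Perm (Fin n) → ℂ,
      ∀ σ : Equiv.Perm (Fin n), ((Equiv.Perm.sign σ : ℤ) : ℂ) =
        ∑ k ∈ Finset.range (n + 1),
          ∑ S ∈ (Finset.univ : Finset (Finset (Fin n))).filter
              (fun S => S.card ≤ (Nat.log 2 n + c) ^ c),
            ∑ τ : Equiv.Perm (Fin n),
              if (Finset.univ.filter fun i : Fin n => σ i = i).card = k ∧ (∀ i ∈ S, σ i = τ i)
              then a k S τ else 0 := by
  obtain ⟨n, hn⟩ := exists_two_mul_level_add_four_le c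
  exact ⟨n, fun ⟨a, ha⟩ => sign_not_mem_cheapCone hn a ha⟩

/-- The registered structural stub, read as horn 2 of the dichotomy with the cone class
`X_c(n) = {f | ∃ a, f = cone expansion of level (log₂ n + c)^c}`: it implies the summit
(same conclusion as `valiantsHypothesis_of_coneExhaustsVP`, obtained here from
`valiantsHypothesis_of_sign_not_mem` + `coneLine_on_horn_two`). [folklore] -/
theorem valiantsHypothesis_of_coneExhaustsVP'
    (H : ∀ χ : (n : ℕ) → Equiv.Perm (Fin n) → ℂ,
      (∀ n (σ τ : Equiv.Perm (Fin n)), IsConj σ τ → χ n σ = χ n τ) →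
      IsVPFamily (k := ℂ)
        (fun n => ∑ σ : Equiv.Perm (Fin n),
          MvPolynomial.C (χ n σ) * ∏ i : Fin n, MvPolynomial.X (σ i, i)) →
      ∃ c : ℕ, ∀ n : ℕ, ∃ a : ℕ → Finset (Fin n) → Equiv.Perm (Fin n) → ℂ,
        ∀ σ : Equiv.Perm (Fin n), ((Equiv.Perm.sign σ : ℤ) : ℂ) * χ n σ =
          ∑ k ∈ Finset.range (n + 1),
            ∑ S ∈ (Finset.univ : Finset (Finset (Fin n))).filter
                (fun S => S.card ≤ (Nat.log 2 n + c) ^ c),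
              ∑ τ : Equiv.Perm (Fin n),
                if (Finset.univ.filter fun i : Fin n => σ i = i).card = k ∧ (∀ i ∈ S, σ i = τ i)
                then a k S τ else 0) :
    _root_.ValiantsHypothesis := by
  refine valiantsHypothesis_of_sign_not_mem
    (fun c n f => ∃ a : ℕ → Finset (Fin n) → Equiv.Perm (Fin n) → ℂ,
      ∀ σ : Equiv.Perm (Fin n), f σ =
        ∑ k ∈ Finset.range (n + 1),
          ∑ S ∈ (Finset.univ : Finset (Finset (Fin n))).filter
              (fun S => S.card ≤ (Nat.log 2 n + c) ^ c),
            ∑ τ : Equiv.Perm (Fin n),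
              if (Finset.univ.filter fun i : Fin n => σ i = i).card = k ∧ (∀ i ∈ S, σ i = τ i)
              then a k S τ else 0)
    (fun χ hχ hVP => H χ hχ hVP) (fun c => coneLine_on_horn_two c)

end Summit.ValiantsHypothesis.ValiantsHypothesis.Theorems.ClassTransfer.Negative
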